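import Literature.Analysis.FluidPDE.ParabolicHeatPotentials
import Literature.Analysis.FluidPDE.LerayHeatTest
import Mathlib.Analysis.Fourier.FourierTransformDeriv
import Mathlib.Analysis.Fourier.Inversion
import Mathlib.Analysis.SpecialFunctions.ImproperIntegrals
import HarnessLib

/-!
# The kernels of `∂ᵥ e^{θΔ}` and `∂ᵤ∂ᵥ∂_w Δ⁻¹ e^{θΔ}` as Fourier multipliers of the heat kernel

Analysis/FluidPDE support file (everything proved) in the decomposition of the named fact
`Literature.Analysis.FluidPDE.LemarieRieusset2016.lemma13_6_duhamel` (`CKNMorreyHolder.lean`: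
Lemarié-Rieusset 2016, §13.9 Step 3 and the proof of Lemma 13.6, pp. 474–478). The Duhamel
representation of the localised velocity involves the potentials `(σ(D)W₊) ⊛ g` of the accepted
`multiplierHeatPotential` (`ParabolicHeatPotentials.lean`), whose kernel is rendered on the
Fourier side as `multiplierHeatKernel σ θ = 𝓕⁻(σ · e^{-4π²θ|ξ|²})`; the two symbols that occur
are those of `∂ᵢ` (the terms `∑ᵢ ∂ᵢhᵢ` of (13.50)) and of `∂ₖ∂ⱼ∂ₗΔ⁻¹` (the term
`∇∂ⱼ∂ₗG * (φuⱼuₗ)` of (13.51)–(13.52)). This file identifies the corresponding kernels with the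
physical-space objects of the tree (dimension three):

* `fourierInv_monomial_mul_heatSymbol` — for `θ > 0`, `n` directions `m : Fin n → ℝ³` and
  `y ∈ ℝ³`: `𝓕⁻[(2πi)ⁿ ∏ᵢ ⟪ξ, mᵢ⟫ e^{-4π²θ|ξ|²}](y) = DⁿW_θ(y)[m₁, …, mₙ]`
  (`W_θ = heatKernel θ` the Gauss–Weierstrass kernel; Mathlib's `iteratedFDeriv_fourier` applied
  to the Gaussian symbol, `𝓕 e^{-4π²θ|·|²} = W_θ`);
* `multiplierHeatKernel_derivSymbol` — **the kernel of `∂ᵥe^{θΔ}`**: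
  `multiplierHeatKernel (ξ ↦ 2πi⟪ξ, v⟫) θ y = ∂ᵥW_θ(y)`;
* `multiplierHeatKernel_oseenSymbol` — **the kernel of `∂ᵤ∂ᵥ∂_wΔ⁻¹e^{aΔ}`** (the Oseen-type
  kernel of Lemarié-Rieusset 2016, §6.2): for `a > 0`,
  `multiplierHeatKernel (ξ ↦ 2πi ⟪ξ,u⟫⟪ξ,v⟫⟪ξ,w⟫/|ξ|²) a x = -∫_a^∞ D³W_s(x)[u, v, w] ds`
  (Fubini over `(a, ∞) × ℝ³` and `∫_a^∞ e^{-4π²s|ξ|²} ds = e^{-4π²a|ξ|²}/(4π²|ξ|²)`), the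
  right-hand side being the Gaussian part of the tree's representation
  `∂ᵤ∂ᵥ∂_w e^{aΔ}Γ₀ = -∫_a^∞ (D³W_s - ∂ᵤ∂ᵥ∂_w e^{sΔ}λ) ds` of the heat flow of the truncated
  Newtonian kernel (`heatD3_newtonNear_eq_neg_integral_Ioi`, `HeatNewtonIdentity.lean`);
* in particular both kernels are **real** (`multiplierHeatKernel_derivSymbol_im`,
  `multiplierHeatKernel_oseenSymbol_im`), and the symbols are smooth off the origin and
  homogeneous of degree one (`contDiffOn_derivSymbol`, `derivSymbol_smul`,
  `contDiffOn_oseenSymbol`, `oseenSymbol_smul`), as required by Prop. 13.4.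

## Mathlib / tree search

Mathlib (all used): `Real.iteratedFDeriv_fourier`, `VectorFourier.fourierPowSMulRight_apply`,
`Real.fourierInv_eq_fourier_comp_neg`, `Real.fourier_eq` / `Real.fourierInv_eq`,
`ContinuousMultilinearMap.integral_apply`, `ContinuousLinearMap.iteratedFDeriv_comp_left`,
`iteratedFDeriv_one_apply`, `integral_exp_mul_Ioi`, `integral_integral_swap`,
`integrable_prod_iff'`. Tree: `multiplierHeatKernel` (`ParabolicHeatPotentials`),
`fourier_transHeatSymbol`, `integrable_pow_mul_heatSymbol` (`LerayHeatTest`), `heatSymbol`,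
`heatKernel` (`UnboundedOperators/HeatKernel`). No kernel identification of Fourier multipliers of
the heat kernel with derivatives of `W_θ` was found (`lean search 'multiplierHeatKernel'`: only
`ParabolicHeatPotentials`, `CKNMorreyHolder`).

## References

* P. G. Lemarié-Rieusset, *The Navier–Stokes Problem in the 21st Century*, CRC Press (2016),
  Prop. 13.4 and its proof (pp. 464–465: the kernels `W₊`, `σ(D)W₊`); §6.2 (the Oseen tensor);
  §13.9 Step 3, (13.50)–(13.52), pp. 474–475. [LemarieRieusset2016]
-/

noncomputable section

open MeasureTheory Set Function Filter Topology Metric Real Complex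
open scoped ENNReal NNReal FourierTransform RealInnerProductSpace ContDiff

namespace Literature.Analysis.FluidPDE

open UnboundedOperators

/-- Local notation for `ℝ³ = EuclideanSpace ℝ (Fin 3)`. -/
local notation "ℝ³" => EuclideanSpace ℝ (Fin 3)

/-! ### The Gaussian symbol: Fourier transform and moments -/

section Gaussian

variable {θ : ℝ}

/-- **`𝓕 e^{-4π²θ|·|²} = W_θ`** (`θ > 0`), as complex-valued functions on `ℝ³` (the tree's
`fourier_transHeatSymbol` with zero translation). [folklore] -/
theorem fourier_heatSymbol (hθ : 0 < θ) :
    𝓕 (fun ξ : ℝ³ => (heatSymbol θ ξ : ℂ)) = fun x : ℝ³ => (heatKernel θ x : ℂ) := by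
  have h1 : (fun ξ : ℝ³ => (heatSymbol θ ξ : ℂ)) = transHeatSymbol 0 θ := by
    funext ξ
    simp [transHeatSymbol]
  funext x
  rw [h1, fourier_transHeatSymbol 0 hθ x, sub_zero]

/-- The norm of the complexified heat symbol. [folklore] -/
theorem norm_heatSymbol_ofReal (θ : ℝ) (ξ : ℝ³) : ‖(heatSymbol θ ξ : ℂ)‖ = heatSymbol θ ξ := by
  rw [Complex.norm_real, Real.norm_of_nonneg (heatSymbol_pos θ ξ).le]

/-- All polynomial moments of the complexified heat symbol are integrable (`θ > 0`). [folklore] -/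
theorem integrable_pow_mul_norm_heatSymbol (hθ : 0 < θ) (k : ℕ) :
    Integrable (fun ξ : ℝ³ => ‖ξ‖ ^ k * ‖(heatSymbol θ ξ : ℂ)‖) := by
  simp only [norm_heatSymbol_ofReal]
  exact integrable_pow_mul_heatSymbol hθ k

/-- The complexified heat symbol is continuous. [folklore] -/
theorem continuous_heatSymbol_ofReal (θ : ℝ) : Continuous fun ξ : ℝ³ => (heatSymbol θ ξ : ℂ) := by
  unfold heatSymbol
  fun_prop

/-- The heat kernel is smooth in space (closed form). [folklore] -/
private theorem contDiff_heatKernel_aux (t : ℝ) {n : WithTop ℕ∞} :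
    ContDiff ℝ n (heatKernel (E := ℝ³) t) := by
  unfold heatKernel
  exact contDiff_const.mul (Real.contDiff_exp.comp (((contDiff_norm_sq ℝ).neg).div_const _))

end Gaussian

/-! ### Fourier multipliers of the Gaussian by monomials are derivatives of the heat kernel -/

section Monomial

variable {θ : ℝ}

/-- **`𝓕⁻[(2πi)ⁿ ∏ᵢ ⟪ξ, mᵢ⟫ e^{-4π²θ|ξ|²}](y) = DⁿW_θ(y)[m₁, …, mₙ]`** for `θ > 0`: the inverse
Fourier transform of the Gaussian symbol multiplied by a monomial of degree `n` in `ξ` is the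
corresponding iterated directional derivative of the heat kernel (Mathlib's
`iteratedFDeriv_fourier`: `Dⁿ𝓕f = 𝓕[(-2πi)ⁿ (∏⟪ξ, mᵢ⟫) f]`, with `𝓕 e^{-4π²θ|·|²} = W_θ`, and
`𝓕⁻g = 𝓕(g ∘ neg)`). [folklore] -/
theorem fourierInv_monomial_mul_heatSymbol (hθ : 0 < θ) {n : ℕ} (m : Fin n → ℝ³) (y : ℝ³) :
    𝓕⁻ (fun ξ : ℝ³ => ((2 * π * I) ^ n * ∏ i, (⟪ξ, m i⟫ : ℂ)) * (heatSymbol θ ξ : ℂ)) y =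
      ((iteratedFDeriv ℝ n (heatKernel θ) y m : ℝ) : ℂ) := by
  set hS : ℝ³ → ℂ := fun ξ => (heatSymbol θ ξ : ℂ) with hS_def
  have hSm : AEStronglyMeasurable hS volume := (continuous_heatSymbol_ofReal θ).aestronglyMeasurable
  have hmom : ∀ k : ℕ, (k : ℕ∞) ≤ ⊤ → Integrable (fun ξ : ℝ³ => ‖ξ‖ ^ k * ‖hS ξ‖) volume :=
    fun k _ => integrable_pow_mul_norm_heatSymbol hθ k
  -- `Dⁿ (𝓕 hS) = 𝓕 (fourierPowSMulRight hS · n)`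
  have hD := Real.iteratedFDeriv_fourier (N := ⊤) hmom hSm (n := n) le_top
  -- evaluate at `y` and `m`
  have hint : Integrable (fun ξ : ℝ³ => VectorFourier.fourierPowSMulRight (innerSL ℝ) hS ξ n)
      volume := VectorFourier.integrable_fourierPowSMulRight _ (hmom n le_top) hSm
  have hev : iteratedFDeriv ℝ n (𝓕 hS) y m =
      𝓕 (fun ξ : ℝ³ => (-(2 * π * I)) ^ n • ((∏ i, ⟪ξ, m i⟫ : ℝ) • hS ξ)) y := by
    rw [hD, Real.fourier_eq, Real.fourier_eq]
    rw [ContinuousMultilinearMap.integral_apply]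
    · refine integral_congr_ae (Eventually.of_forall fun ξ => ?_)
      show (𝐞 (-⟪ξ, y⟫) • VectorFourier.fourierPowSMulRight (innerSL ℝ) hS ξ n) m =
        𝐞 (-⟪ξ, y⟫) • ((-(2 * π * I)) ^ n • ((∏ i, ⟪ξ, m i⟫ : ℝ) • hS ξ))
      rw [Circle.smul_def, Circle.smul_def, smul_apply,
        VectorFourier.fourierPowSMulRight_apply]
      rfl
    · exact (Real.fourierIntegral_convergent_iff y).2 hint
  -- the left-hand side as a Fourier transform
  have hL : 𝓕⁻ (fun ξ : ℝ³ => ((2 * π * I) ^ n * ∏ i, (⟪ξ, m i⟫ : ℂ)) * hS ξ) y =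
      𝓕 (fun ξ : ℝ³ => (-(2 * π * I)) ^ n • ((∏ i, ⟪ξ, m i⟫ : ℝ) • hS ξ)) y := by
    rw [Real.fourierInv_eq_fourier_comp_neg]
    have hfun : (fun ξ : ℝ³ => ((2 * π * I) ^ n * ∏ i, (⟪-ξ, m i⟫ : ℂ)) * hS (-ξ)) =
        fun ξ : ℝ³ => (-(2 * π * I)) ^ n • ((∏ i, ⟪ξ, m i⟫ : ℝ) • hS ξ) := by
      funext ξ
      simp only [hS_def, heatSymbol_neg, inner_neg_left, Complex.ofReal_neg, smul_eq_mul,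
        Complex.real_smul, Complex.ofReal_prod]
      rw [Finset.prod_neg, Finset.card_univ, Fintype.card_fin, neg_pow (2 * π * I)]
      ring
    rw [hfun]
  rw [hL, ← hev, fourier_heatSymbol hθ]
  -- `Dⁿ (ofReal ∘ W_θ) = ofReal ∘ DⁿW_θ`
  have hcomp : (fun x : ℝ³ => (heatKernel θ x : ℂ)) = Complex.ofRealCLM ∘ heatKernel θ := by
    funext x; rfl
  rw [hcomp, ContinuousLinearMap.iteratedFDeriv_comp_left Complex.ofRealCLM
    ((contDiff_heatKernel_aux θ (n := n)).contDiffAt) le_rfl]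
  rfl

end Monomial

/-! ### The kernel of `∂ᵥ e^{θΔ}` -/

section Deriv

variable {θ : ℝ}

/-- The symbol `2πi⟪ξ, v⟫` of the directional derivative `∂ᵥ` (Mathlib's normalisation of `𝓕`). [folklore] -/
def derivSymbol (v : ℝ³) (ξ : ℝ³) : ℂ := 2 * π * I * (⟪ξ, v⟫ : ℂ)

/-- Unfolding `derivSymbol`. [folklore] -/
@[simp]
theorem derivSymbol_apply (v ξ : ℝ³) : derivSymbol v ξ = 2 * π * I * (⟪ξ, v⟫ : ℂ) := rfl

/-- `derivSymbol v` is smooth (everywhere, in particular off the origin). [folklore] -/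
theorem contDiffOn_derivSymbol (v : ℝ³) :
    ContDiffOn ℝ ((⊤ : ℕ∞) : WithTop ℕ∞) (derivSymbol v) {0}ᶜ := by
  have h : ContDiff ℝ ((⊤ : ℕ∞) : WithTop ℕ∞) (derivSymbol v) := by
    unfold derivSymbol
    exact contDiff_const.mul (Complex.ofRealCLM.contDiff.comp (contDiff_id.inner ℝ contDiff_const))
  exact h.contDiffOn

/-- `derivSymbol v` is homogeneous of degree one. [folklore] -/
theorem derivSymbol_smul (v : ℝ³) (c : ℝ) (_hc : 0 < c) (ξ : ℝ³) :
    derivSymbol v (c • ξ) = (c : ℂ) * derivSymbol v ξ := by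
  simp only [derivSymbol_apply, inner_smul_left, conj_trivial, Complex.ofReal_mul]
  ring

/-- **The kernel of `∂ᵥe^{θΔ}` is `∂ᵥW_θ`**: `multiplierHeatKernel (ξ ↦ 2πi⟪ξ, v⟫) θ y = ∂ᵥW_θ(y)`
for `θ > 0` (the case `n = 1` of `fourierInv_monomial_mul_heatSymbol`). [folklore] -/
theorem multiplierHeatKernel_derivSymbol (hθ : 0 < θ) (v y : ℝ³) :
    multiplierHeatKernel (derivSymbol v) θ y = ((fderiv ℝ (heatKernel θ) y v : ℝ) : ℂ) := by
  have h := fourierInv_monomial_mul_heatSymbol hθ ![v] y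
  simp only [Fin.prod_univ_one, Matrix.cons_val_zero, pow_one, iteratedFDeriv_one_apply] at h
  rw [← h]
  rfl

/-- The kernel of `∂ᵥe^{θΔ}` is real. [folklore] -/
theorem multiplierHeatKernel_derivSymbol_im (hθ : 0 < θ) (v y : ℝ³) :
    (multiplierHeatKernel (derivSymbol v) θ y).im = 0 := by
  rw [multiplierHeatKernel_derivSymbol hθ, Complex.ofReal_im]

/-- The kernel of `∂ᵥe^{θΔ}`, real part. [folklore] -/
theorem multiplierHeatKernel_derivSymbol_re (hθ : 0 < θ) (v y : ℝ³) :
    (multiplierHeatKernel (derivSymbol v) θ y).re = fderiv ℝ (heatKernel θ) y v := by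
  rw [multiplierHeatKernel_derivSymbol hθ, Complex.ofReal_re]

end Deriv

/-! ### The kernel of `∂ᵤ∂ᵥ∂_w Δ⁻¹ e^{aΔ}` -/

section Oseen

variable {a : ℝ}

/-- The symbol `2πi ⟪ξ,u⟫⟪ξ,v⟫⟪ξ,w⟫/|ξ|²` of `∂ᵤ∂ᵥ∂_wΔ⁻¹` (Mathlib's normalisation of `𝓕`:
`∂ᵥ ↔ 2πi⟪ξ,v⟫`, `Δ⁻¹ ↔ -1/(4π²|ξ|²)`; junk value `0` at `ξ = 0`). [folklore] -/
def oseenSymbol (u v w : ℝ³) (ξ : ℝ³) : ℂ :=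
  2 * π * I * ((⟪ξ, u⟫ * ⟪ξ, v⟫ * ⟪ξ, w⟫ / ‖ξ‖ ^ 2 : ℝ) : ℂ)

/-- Unfolding `oseenSymbol`. [folklore] -/
theorem oseenSymbol_apply (u v w ξ : ℝ³) :
    oseenSymbol u v w ξ = 2 * π * I * ((⟪ξ, u⟫ * ⟪ξ, v⟫ * ⟪ξ, w⟫ / ‖ξ‖ ^ 2 : ℝ) : ℂ) := rfl

/-- `oseenSymbol u v w` is smooth off the origin. [folklore] -/
theorem contDiffOn_oseenSymbol (u v w : ℝ³) :
    ContDiffOn ℝ ((⊤ : ℕ∞) : WithTop ℕ∞) (oseenSymbol u v w) {0}ᶜ := by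
  have h1 : ContDiffOn ℝ ((⊤ : ℕ∞) : WithTop ℕ∞)
      (fun ξ : ℝ³ => ⟪ξ, u⟫ * ⟪ξ, v⟫ * ⟪ξ, w⟫ / ‖ξ‖ ^ 2) {0}ᶜ := by
    refine ContDiffOn.div ?_ ?_ fun ξ hξ => ?_
    · exact (((contDiff_id.inner ℝ contDiff_const).mul (contDiff_id.inner ℝ contDiff_const)).mul
        (contDiff_id.inner ℝ contDiff_const)).contDiffOn
    · exact (contDiff_norm_sq ℝ).contDiffOn
    · exact pow_ne_zero 2 (norm_ne_zero_iff.2 hξ)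
  unfold oseenSymbol
  exact contDiffOn_const.mul (Complex.ofRealCLM.contDiff.comp_contDiffOn h1)

/-- `oseenSymbol u v w` is homogeneous of degree one. [folklore] -/
theorem oseenSymbol_smul (u v w : ℝ³) (c : ℝ) (hc : 0 < c) (ξ : ℝ³) :
    oseenSymbol u v w (c • ξ) = (c : ℂ) * oseenSymbol u v w ξ := by
  simp only [oseenSymbol_apply, inner_smul_left, conj_trivial, norm_smul, Real.norm_eq_abs,
    abs_of_pos hc]
  by_cases hξ : ξ = 0
  · simp [hξ]
  · have hn : ‖ξ‖ ≠ 0 := norm_ne_zero_iff.2 hξ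
    have h : c * ⟪ξ, u⟫ * (c * ⟪ξ, v⟫) * (c * ⟪ξ, w⟫) / (c * ‖ξ‖) ^ 2 =
        c * (⟪ξ, u⟫ * ⟪ξ, v⟫ * ⟪ξ, w⟫ / ‖ξ‖ ^ 2) := by
      field_simp
    rw [h, Complex.ofReal_mul]
    ring

/-- `∫_a^∞ e^{-4π²s|ξ|²} ds = e^{-4π²a|ξ|²} / (4π²|ξ|²)` for `ξ ≠ 0`. [folklore] -/
theorem integral_Ioi_heatSymbol {ξ : ℝ³} (hξ : ξ ≠ 0) (a : ℝ) :
    ∫ s in Ioi a, heatSymbol s ξ = heatSymbol a ξ / ((2 * π) ^ 2 * ‖ξ‖ ^ 2) := by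
  have hr : -(2 * π) ^ 2 * ‖ξ‖ ^ 2 < 0 := by
    have h0 : 0 < ‖ξ‖ := norm_pos_iff.2 hξ
    have h1 : 0 < (2 * π) ^ 2 * ‖ξ‖ ^ 2 := by positivity
    linarith
  have h := integral_exp_mul_Ioi hr a
  have heq : (fun s : ℝ => heatSymbol s ξ) = fun s => Real.exp (-(2 * π) ^ 2 * ‖ξ‖ ^ 2 * s) := by
    funext s; simp only [heatSymbol]; congr 1; ring
  rw [heq, h, heatSymbol]
  rw [show -(2 * π) ^ 2 * ‖ξ‖ ^ 2 * a = -(2 * π) ^ 2 * a * ‖ξ‖ ^ 2 by ring]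
  field_simp

/-- `s ↦ e^{-4π²s|ξ|²}` is integrable on `(a, ∞)` for `ξ ≠ 0`. [folklore] -/
theorem integrableOn_Ioi_heatSymbol {ξ : ℝ³} (hξ : ξ ≠ 0) (a : ℝ) :
    IntegrableOn (fun s : ℝ => heatSymbol s ξ) (Ioi a) := by
  have hr : -(2 * π) ^ 2 * ‖ξ‖ ^ 2 < 0 := by
    have h0 : 0 < ‖ξ‖ := norm_pos_iff.2 hξ
    have h1 : 0 < (2 * π) ^ 2 * ‖ξ‖ ^ 2 := by positivity
    linarith
  have h := integrableOn_exp_mul_Ioi hr a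
  have heq : (fun s : ℝ => heatSymbol s ξ) = fun s => Real.exp (-(2 * π) ^ 2 * ‖ξ‖ ^ 2 * s) := by
    funext s; simp only [heatSymbol]; congr 1; ring
  rw [heq]
  exact h

/-- The cubic monomial of the Oseen symbol (the numerator of `fourierInv_monomial_mul_heatSymbol`
for `n = 3`). [folklore] -/
theorem prod_inner_three (u v w ξ : ℝ³) :
    (∏ i, (⟪ξ, ![u, v, w] i⟫ : ℂ)) = ((⟪ξ, u⟫ * ⟪ξ, v⟫ * ⟪ξ, w⟫ : ℝ) : ℂ) := by
  rw [Fin.prod_univ_three]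
  simp only [Matrix.cons_val_zero, Matrix.cons_val_one, Matrix.cons_val, Complex.ofReal_mul]

/-- The space–time integrand of the Oseen kernel is dominated by
`(2π)³‖u‖‖v‖‖w‖ · ‖ξ‖³ e^{-4π²s|ξ|²}`. [folklore] -/
theorem norm_monomial_mul_heatSymbol_le (u v w : ℝ³) (x : ℝ³) (s : ℝ) (ξ : ℝ³) :
    ‖(𝐞 ⟪ξ, x⟫) • (((2 * π * I) ^ 3 * ∏ i, (⟪ξ, ![u, v, w] i⟫ : ℂ)) * (heatSymbol s ξ : ℂ))‖ ≤
      (2 * π) ^ 3 * (‖u‖ * ‖v‖ * ‖w‖) * (‖ξ‖ ^ 3 * heatSymbol s ξ) := by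
  rw [Circle.smul_def, norm_smul, Circle.norm_coe, one_mul, prod_inner_three, norm_mul, norm_mul,
    norm_heatSymbol_ofReal, Complex.norm_real, norm_pow, norm_mul, norm_mul, Complex.norm_real,
    Complex.norm_I, mul_one, Complex.norm_ofNat, Real.norm_eq_abs, abs_of_pos Real.pi_pos,
    Real.norm_eq_abs]
  have h1 : |⟪ξ, u⟫ * ⟪ξ, v⟫ * ⟪ξ, w⟫| ≤ ‖u‖ * ‖v‖ * ‖w‖ * ‖ξ‖ ^ 3 := by
    rw [abs_mul, abs_mul]
    calc |⟪ξ, u⟫| * |⟪ξ, v⟫| * |⟪ξ, w⟫| ≤ (‖ξ‖ * ‖u‖) * (‖ξ‖ * ‖v‖) * (‖ξ‖ * ‖w‖) := by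
          gcongr <;> exact abs_real_inner_le_norm _ _
      _ = ‖u‖ * ‖v‖ * ‖w‖ * ‖ξ‖ ^ 3 := by ring
  have h2 : 0 ≤ heatSymbol s ξ := (heatSymbol_pos s ξ).le
  calc (2 * π) ^ 3 * |⟪ξ, u⟫ * ⟪ξ, v⟫ * ⟪ξ, w⟫| * heatSymbol s ξ
      ≤ (2 * π) ^ 3 * (‖u‖ * ‖v‖ * ‖w‖ * ‖ξ‖ ^ 3) * heatSymbol s ξ := by gcongr
    _ = (2 * π) ^ 3 * (‖u‖ * ‖v‖ * ‖w‖) * (‖ξ‖ ^ 3 * heatSymbol s ξ) := by ring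

/-- The dominating function `(s, ξ) ↦ ‖ξ‖³ e^{-4π²s|ξ|²}` is integrable on `(a, ∞) × ℝ³` for
`a > 0`: its `s`-integral is `‖ξ‖ e^{-4π²a|ξ|²}/(4π²)`, an integrable function of `ξ`. [folklore] -/
theorem integrable_pow_three_mul_heatSymbol_prod (ha : 0 < a) :
    Integrable (fun p : ℝ × ℝ³ => ‖p.2‖ ^ 3 * heatSymbol p.1 p.2)
      ((volume.restrict (Ioi a)).prod (volume : Measure ℝ³)) := by
  have hmeas : AEStronglyMeasurable (fun p : ℝ × ℝ³ => ‖p.2‖ ^ 3 * heatSymbol p.1 p.2)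
      ((volume.restrict (Ioi a)).prod (volume : Measure ℝ³)) := by
    refine Continuous.aestronglyMeasurable ?_
    unfold heatSymbol
    fun_prop
  rw [integrable_prod_iff' hmeas]
  constructor
  · refine Eventually.of_forall fun ξ => ?_
    dsimp only
    by_cases hξ : ξ = 0
    · simp only [hξ, norm_zero, ne_eq, OfNat.ofNat_ne_zero, not_false_eq_true, zero_pow, zero_mul]
      exact integrable_zero _ _ _
    · exact (integrableOn_Ioi_heatSymbol hξ a).const_mul _
  · have heq : (fun ξ : ℝ³ => ∫ s in Ioi a, ‖‖ξ‖ ^ 3 * heatSymbol s ξ‖) =ᵐ[volume]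
        fun ξ : ℝ³ => (1 / (2 * π) ^ 2) * (‖ξ‖ ^ 1 * heatSymbol a ξ) := by
      have h0 : ∀ᵐ ξ : ℝ³ ∂volume, ξ ≠ 0 := by
        have : (volume : Measure ℝ³) {0} = 0 := measure_singleton 0
        filter_upwards [measure_eq_zero_iff_ae_notMem.1 this] with ξ hξ
        simpa using hξ
      filter_upwards [h0] with ξ hξ
      have hn : ‖ξ‖ ≠ 0 := norm_ne_zero_iff.2 hξ
      have h1 : (fun s : ℝ => ‖‖ξ‖ ^ 3 * heatSymbol s ξ‖) = fun s => ‖ξ‖ ^ 3 * heatSymbol s ξ := by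
        funext s
        rw [Real.norm_of_nonneg (mul_nonneg (pow_nonneg (norm_nonneg _) 3) (heatSymbol_pos s ξ).le)]
      rw [h1, integral_const_mul, integral_Ioi_heatSymbol hξ a]
      field_simp
    rw [integrable_congr heq]
    exact (integrable_pow_mul_heatSymbol ha 1).const_mul _

/-- **The kernel of `∂ᵤ∂ᵥ∂_wΔ⁻¹e^{aΔ}`**: for `a > 0`,
`multiplierHeatKernel (oseenSymbol u v w) a x = -∫_a^∞ D³W_s(x)[u, v, w] ds`. Each `D³W_s(x)[u,v,w]`
is `𝓕⁻[(2πi)³⟪ξ,u⟫⟪ξ,v⟫⟪ξ,w⟫ e^{-4π²s|ξ|²}](x)` (`fourierInv_monomial_mul_heatSymbol`); Fubini over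
`(a, ∞) × ℝ³` (dominated by `‖ξ‖³e^{-4π²s|ξ|²}`) and `∫_a^∞ e^{-4π²s|ξ|²} ds = e^{-4π²a|ξ|²}/(4π²|ξ|²)`
give `𝓕⁻[(2πi)³/(4π²) ⟪ξ,u⟫⟪ξ,v⟫⟪ξ,w⟫/|ξ|² e^{-4π²a|ξ|²}]`, and `(2πi)³/(4π²) = -2πi`. This is the
Gaussian part of the tree's `heatD3_newtonNear_eq_neg_integral_Ioi` (the Oseen tensor of
Lemarié-Rieusset 2016, §6.2). [cite: LemarieRieusset2016, Prop. 13.4 proof p. 465 and §6.2] -/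
theorem multiplierHeatKernel_oseenSymbol (ha : 0 < a) (u v w x : ℝ³) :
    multiplierHeatKernel (oseenSymbol u v w) a x =
      -(((∫ s in Ioi a, iteratedFDeriv ℝ 3 (heatKernel s) x ![u, v, w] : ℝ) : ℂ)) := by
  -- the integrand on `(a, ∞) × ℝ³`
  set F : ℝ × ℝ³ → ℂ := fun p => (𝐞 ⟪p.2, x⟫) •
    (((2 * π * I) ^ 3 * ∏ i, (⟪p.2, ![u, v, w] i⟫ : ℂ)) * (heatSymbol p.1 p.2 : ℂ)) with hF_def
  have hFc : Continuous F := by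
    have h1 : Continuous fun p : ℝ × ℝ³ => ((𝐞 ⟪p.2, x⟫ : Circle) : ℂ) :=
      continuous_subtype_val.comp (Real.continuous_fourierChar.comp (continuous_snd.inner
        continuous_const))
    have h2 : Continuous fun p : ℝ × ℝ³ => ∏ i, (⟪p.2, ![u, v, w] i⟫ : ℂ) :=
      continuous_finsetProd _ fun i _ =>
        Complex.continuous_ofReal.comp (continuous_snd.inner continuous_const)
    have h3 : Continuous fun p : ℝ × ℝ³ => (heatSymbol p.1 p.2 : ℂ) := by
      refine Complex.continuous_ofReal.comp ?_
      unfold heatSymbol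
      fun_prop
    have h4 : Continuous fun p : ℝ × ℝ³ => ((𝐞 ⟪p.2, x⟫ : Circle) : ℂ) *
        (((2 * π * I) ^ 3 * ∏ i, (⟪p.2, ![u, v, w] i⟫ : ℂ)) * (heatSymbol p.1 p.2 : ℂ)) :=
      h1.mul ((continuous_const.mul h2).mul h3)
    refine h4.congr fun p => ?_
    simp only [hF_def, Circle.smul_def, smul_eq_mul]
  have hFm : AEStronglyMeasurable F ((volume.restrict (Ioi a)).prod (volume : Measure ℝ³)) :=
    hFc.aestronglyMeasurable
  have hFi : Integrable F ((volume.restrict (Ioi a)).prod (volume : Measure ℝ³)) := by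
    refine ((integrable_pow_three_mul_heatSymbol_prod ha).const_mul
      ((2 * π) ^ 3 * (‖u‖ * ‖v‖ * ‖w‖))).mono' hFm (Eventually.of_forall fun p => ?_)
    exact norm_monomial_mul_heatSymbol_le u v w x p.1 p.2
  -- each time slice of `F` integrates (in `ξ`) to `D³W_s(x)[u,v,w]`
  have hslice : ∀ s ∈ Ioi a, (∫ ξ, F (s, ξ)) =
      ((iteratedFDeriv ℝ 3 (heatKernel s) x ![u, v, w] : ℝ) : ℂ) := by
    intro s hs
    have hs0 : 0 < s := ha.trans hs
    have h := fourierInv_monomial_mul_heatSymbol hs0 ![u, v, w] x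
    rw [Real.fourierInv_eq] at h
    simp only [hF_def]
    exact h
  -- the real integral as a complex one, then Fubini
  have hstep1 : (((∫ s in Ioi a, iteratedFDeriv ℝ 3 (heatKernel s) x ![u, v, w] : ℝ) : ℂ)) =
      ∫ s in Ioi a, ∫ ξ, F (s, ξ) := by
    rw [← integral_complex_ofReal]
    exact (setIntegral_congr_fun measurableSet_Ioi hslice).symm
  have hswap : (∫ s in Ioi a, ∫ ξ, F (s, ξ)) = ∫ ξ, ∫ s in Ioi a, F (s, ξ) :=
    integral_integral_swap hFi
  -- the inner time integral
  have hI3 : I ^ 3 = -I := by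
    rw [pow_succ, Complex.I_sq]
    ring
  have hinner : ∀ ξ : ℝ³, ξ ≠ 0 → (∫ s in Ioi a, F (s, ξ)) =
      ((𝐞 ⟪ξ, x⟫ : Circle) : ℂ) * (-(oseenSymbol u v w ξ * (heatSymbol a ξ : ℂ))) := by
    intro ξ hξ
    have hn : ‖ξ‖ ≠ 0 := norm_ne_zero_iff.2 hξ
    have hnC : ((‖ξ‖ : ℝ) : ℂ) ≠ 0 := by exact_mod_cast hn
    have hπ : ((π : ℝ) : ℂ) ≠ 0 := by exact_mod_cast Real.pi_pos.ne'
    simp only [hF_def, Circle.smul_def, smul_eq_mul]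
    rw [integral_const_mul, integral_const_mul, integral_complex_ofReal,
      integral_Ioi_heatSymbol hξ a, prod_inner_three, oseenSymbol_apply]
    congr 1
    have h8 : (2 * (π : ℂ) * I) ^ 3 = -(8 * (π : ℂ) ^ 3) * I := by
      rw [mul_pow, hI3]; ring
    rw [h8]
    push_cast
    field_simp
    ring
  have hinner_ae : (fun ξ : ℝ³ => ∫ s in Ioi a, F (s, ξ)) =ᵐ[volume]
      fun ξ => ((𝐞 ⟪ξ, x⟫ : Circle) : ℂ) * (-(oseenSymbol u v w ξ * (heatSymbol a ξ : ℂ))) := by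
    have h0 : ∀ᵐ ξ : ℝ³ ∂volume, ξ ≠ 0 := by
      have : (volume : Measure ℝ³) {0} = 0 := measure_singleton 0
      filter_upwards [measure_eq_zero_iff_ae_notMem.1 this] with ξ hξ
      simpa using hξ
    filter_upwards [h0] with ξ hξ
    exact hinner ξ hξ
  rw [hstep1, hswap, integral_congr_ae hinner_ae, multiplierHeatKernel, Real.fourierInv_eq,
    ← integral_neg]
  refine integral_congr_ae (Eventually.of_forall fun ξ => ?_)
  simp only [Circle.smul_def, smul_eq_mul, mul_neg, neg_neg]

/-- The kernel of `∂ᵤ∂ᵥ∂_wΔ⁻¹e^{aΔ}` is real. [folklore] -/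
theorem multiplierHeatKernel_oseenSymbol_im (ha : 0 < a) (u v w x : ℝ³) :
    (multiplierHeatKernel (oseenSymbol u v w) a x).im = 0 := by
  rw [multiplierHeatKernel_oseenSymbol ha, Complex.neg_im, Complex.ofReal_im, neg_zero]

/-- The kernel of `∂ᵤ∂ᵥ∂_wΔ⁻¹e^{aΔ}`, real part. [folklore] -/
theorem multiplierHeatKernel_oseenSymbol_re (ha : 0 < a) (u v w x : ℝ³) :
    (multiplierHeatKernel (oseenSymbol u v w) a x).re =
      -∫ s in Ioi a, iteratedFDeriv ℝ 3 (heatKernel s) x ![u, v, w] := by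
  rw [multiplierHeatKernel_oseenSymbol ha, Complex.neg_re, Complex.ofReal_re]

end Oseen

end Literature.Analysis.FluidPDE
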